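import Mathlib
import Literature.Geometry.Symplectic.JHolomorphicMap
import Summits.SmoothPoincare4.SmoothPoincare4.Theorems.SullivanDualTameOrBrodyR4PencilDefs
import Summits.SmoothPoincare4.SmoothPoincare4.Theorems.SullivanDualTameOrBrodyR4ContinuityEstimates
import Summits.SmoothPoincare4.SmoothPoincare4.Theorems.SullivanDualTameOrBrodyR4StubCompactnessLoc
import Summits.SmoothPoincare4.SmoothPoincare4.Theorems.SullivanDualTameOrBrodyR4StubLimitTails
import Summits.SmoothPoincare4.SmoothPoincare4.Theorems.SullivanDualTameOrBrodyR4StubLimitCrossings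

/-!
# Closedness modulo blow-up with the convergent subsequence exposed (crux `TameOrBrodyR4`, stmt-SmoothPoincare4-7826, line `Sketch`, skeleton v17)

Registered helper `helper_closedOrBlowupConv` of the continuity method for Gromov's anchored
pencils (vocabulary `Theorems/SullivanDualTameOrBrodyR4PencilDefs.lean`). It is the closedness
step `helper_closedOrBlowup` (`Theorems/SullivanDualTameOrBrodyR4ContinuityClosedness.lean`) with
the convergent subsequence made visible: a sequence of normalised members `u n` with non-honest
asymptotic values `b n → b⋆` (`|b n| < 2R`) EITHER has a subsequence `u (φ k)` converging in
`C¹_loc` to a member `v` with asymptotic value `b⋆` OR produces blow-up data (a compact `K` and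
entire `C^∞` flat-`J`-holomorphic maps sending the closed unit disc into `K` with exploding
derivative at `0`). The subsequence is needed by the lead to feed the local-uniqueness clause of
the local family (openness of the set of values with a unique member).

Proof: the uniform confinement `‖u n ξ‖ ≤ |ξ| + 10R` (`helper_memberEstimates`); if the first
derivatives are unbounded on some disc, translate the bad points to the origin
(`Continuity.blowup_of_unbounded`); otherwise `stub_compactnessLoc` extracts a `C¹_loc`-convergent
subsequence with an entire `C^∞` flat-`J`-holomorphic limit `v`, which inherits the asymptotics and
the normalisation (`stub_limitTails`), the unique transverse far crossings (`stub_limitCrossings`,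
Hurwitz), and is embedded by the deep input `HasEmbeddedLimits` (adjunction) — so `v` is a member,
and we return it together with the subsequence and both convergences.

References: M. Gromov, Invent. Math. 82 (1985), §2.4.A; D. McDuff, D. Salamon, *J-holomorphic
curves and symplectic topology* (2012), Thm 2.6.4 (adjunction), §4 (compactness).
-/

-- the registered namespace `Summit.SmoothPoincare4.SmoothPoincare4.…` repeats a component
set_option linter.dupNamespace false

noncomputable section

open scoped ContDiff Topology
open Filter Set Metric Literature.Geometry.Symplectic

namespace Summit.SmoothPoincare4.SmoothPoincare4.Cruxes.TameOrBrodyR4.Sketch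

/-- Local notation for the model space `ℝ⁴ = EuclideanSpace ℝ (Fin 4)`. -/
local notation "E4" => EuclideanSpace ℝ (Fin 4)

/-- **Registered helper `helper_closedOrBlowupConv`: closedness modulo blow-up with the convergent
subsequence exposed.** A sequence of members with non-honest asymptotic values `b n → b⋆` (all
`|b n| < 2R`) either has a subsequence `u ∘ φ` converging locally uniformly, together with its
first derivatives, to a member `v` with asymptotic value `b⋆`, or yields blow-up data: uniform
confinement (`helper_memberEstimates`) and the gradient dichotomy; in the bounded case
`stub_compactnessLoc` gives the subsequence and a `C¹_loc`-limit which inherits the tails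
(`stub_limitTails`), the far crossings (`stub_limitCrossings`) and is embedded by
`HasEmbeddedLimits`. -/
theorem helper_closedOrBlowupConv (J : E4 → E4 →L[ℝ] E4) (R : ℝ) (P Q : E4 →L[ℝ] ℂ)
    (eP eQ : ℂ →L[ℝ] E4)
    (hR : 0 < R) (hJs : ContDiff ℝ ∞ J) (hJ2 : ∀ x v, J x (J x v) = -v)
    (hPQ : IsCoordFrame P Q eP eQ)
    (hJP : ∀ x : E4, R ≤ ‖x‖ → ∀ v, P (J x v) = Complex.I * P v)
    (hJQ : ∀ x : E4, R ≤ ‖x‖ → ∀ v, Q (J x v) = Complex.I * Q v)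
    (hEL : HasEmbeddedLimits J R P Q) (b : ℕ → ℂ) (u : ℕ → ℂ → E4) (bs : ℂ)
    (hm : ∀ n, IsPencilMember J R P Q (b n) (u n)) (hb2 : ∀ n, ‖b n‖ < 2 * R)
    (hbs : Tendsto b atTop (𝓝 bs)) :
    (∃ (v : ℂ → E4) (φ : ℕ → ℕ), StrictMono φ ∧ IsPencilMember J R P Q bs v ∧
      TendstoLocallyUniformly (fun k => u (φ k)) v atTop ∧
      TendstoLocallyUniformly (fun k => fderiv ℝ (u (φ k))) (fderiv ℝ v) atTop) ∨
    (∃ (K : Set E4) (f : ℕ → ℂ → E4), IsCompact K ∧ (∀ n, ContDiff ℝ ∞ (f n)) ∧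
      (∀ n, IsJHolomorphicFlat J (f n)) ∧ (∀ n (z : ℂ), ‖z‖ ≤ 1 → f n z ∈ K) ∧
      Tendsto (fun n => ‖fderiv ℝ (f n) 0‖) atTop atTop) := by
  have hest := fun n => helper_memberEstimates J R P Q eP eQ hR hPQ hJP hJQ (hm n) (hb2 n)
  have hK : ∀ ρ : ℝ, ∃ C : ℝ, ∀ n (z : ℂ), ‖z‖ ≤ ρ → ‖u n z‖ ≤ C := fun ρ =>
    ⟨ρ + 10 * R, fun n z hz => ((hest n).2.2.2.2.2 z).trans (by linarith)⟩
  by_cases hD : ∀ ρ : ℝ, ∃ M : ℝ, ∀ n (z : ℂ), ‖z‖ ≤ ρ → ‖fderiv ℝ (u n) z‖ ≤ M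
  · left
    obtain ⟨v, φ, hφ, hv, hvJ, hloc, hdloc⟩ :=
      stub_compactnessLoc J hJs hJ2 u (fun n => (hm n).1) (fun n => (hm n).2.1) hK hD
    have hm' : ∀ k, IsPencilMember J R P Q (b (φ k)) (u (φ k)) := fun k => hm (φ k)
    have hb' : Tendsto (fun k => b (φ k)) atTop (𝓝 bs) := hbs.comp hφ.tendsto_atTop
    obtain ⟨h5, h6, -, h7e⟩ := stub_limitTails R hR P Q (fun k => u (φ k)) v (fun k => b (φ k)) bs
      hv.continuous hb' hloc (fun k c hc => ((hm' k).2.2.2.2.2.2.1 c hc).exists)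
      (fun k => (hest (φ k)).2.2.2.1) (fun k => (hest (φ k)).2.2.2.2.1)
    obtain ⟨h7u, h8⟩ := stub_limitCrossings J R hR P (PencilDefs.norm_P_le hPQ) hJP
      (fun k => u (φ k)) v (fun k => (hm' k).1) (fun k => (hm' k).2.1) hv hvJ hloc
      (fun k => (hm' k).2.2.2.2.2.2.1) (fun k => (hm' k).2.2.2.2.2.2.2) h6
    have h7 : ∀ c : ℂ, 2 * R < ‖c‖ → ∃! ξ, P (v ξ) = c := fun c hc => by
      obtain ⟨ξ, hξ⟩ := h7e c hc
      exact ⟨ξ, hξ, fun ξ' h' => h7u c hc ξ' ξ h' hξ⟩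
    obtain ⟨hinj, himm⟩ := hEL (fun k => b (φ k)) (fun k => u (φ k)) bs v hm' hb' hv hvJ hloc
      hdloc h5 h6 h7 h8
    exact ⟨v, φ, hφ, ⟨hv, hvJ, hinj, himm, h5, h6, h7, h8⟩, hloc, hdloc⟩
  · right
    push Not at hD
    obtain ⟨ρ, hρ⟩ := hD
    exact Continuity.blowup_of_unbounded J u (fun n => (hm n).1) (fun n => (hm n).2.1) ρ
      (ρ + 1 + 10 * R) (fun n z hz => ((hest n).2.2.2.2.2 z).trans (by linarith)) hρ

end Summit.SmoothPoincare4.SmoothPoincare4.Cruxes.TameOrBrodyR4.Sketch
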